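import Literature.NumberTheory.LFunctions.Zhang2022.RepairBlenNuLipschitz
import Literature.NumberTheory.LFunctions.Zhang2022.Section4Prop22Eventually
import Literature.NumberTheory.LFunctions.Zhang2022.Section7Prop71Holds
import HarnessLib

/-!
# Zhang (2022), programme F-S3 §E (cell landau-siegel, barrier extension): the Lipschitz νψ-overhang row E-20 /
# the Lipschitz image of E-17 with ALL FOUR displayed skeleton nodes DISCHARGED — `Prop71 c′` (every `c′`),
# `Lemma81 c′`, `Prop22i`, `Lemma23 c′` (every sufficiently large `c′`) are TREE THEOREMS; the closed twins (LEAF)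

Y. Zhang, *Discrete mean estimates and the Landau–Siegel zero*, arXiv:2211.02515v1 [Zhang2022LandauSiegel] — an
unrefereed manuscript under adjudication. **WHAT THIS IS NOT: not a claim about Theorems 1–2 of arXiv:2211.02515,
about Landau–Siegel zeros, about a repaired `Margin232`, or about Parity. Theorems only (kind proof): 0 new
definitions, 0 new facts, no class / row / verdict of `Repair.Rplusplus<k>` or of `blenWord<k>` changes. This is a
LEAF (nobody imports it): it composes the landed implications of `RepairBlenNuLipschitz` Part 5 (p470276 / v4
p471332; REF-E verdict 34 → E-20: «E-17's E-074′ slot DISCHARGED on the Lipschitz image modulo Prop71 / Lemma81 /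
Prop22i / Lemma23») and of `KnifeEdgeNuInvisiblePsiOne` Part 5 (p468144) with the tree theorems that discharge those
four nodes: `Section7cStatements.prop71X_holds` (Proposition 7.1 for EVERY `c′`, Section7Prop71Holds.lean — with
the three adjudicated repairs G-adj2-1/2/3 in place of the three not-derivable-as-printed steps, as that file says),
`Skeleton.prop22i_holds`, `Skeleton.partOne_eventually` (Prop 2.2, Lemma 2.3, Lemma 8.1 under ONE threshold
`c₀ ≥ 0`, Section4Prop22Eventually.lean). The programme SEARCHES and TYPES; no claim about Landau–Siegel zeros,
Theorems 1–2 of arXiv:2211.02515 or a repaired Margin232 until a kernel theorem says so.**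

**Effect on the books (for ls-barrier-ref / ls-barrier-plan / ls-obj-plan; BARRIER-STATE §2′ N12).** REF-E E-20's
absolute-currency clause «modulo the four named nodes Prop71/Lemma81/Prop22i/Lemma23» becomes «modulo NOTHING, for
every sufficiently large detector-shift constant `c′`» (`nuMeanInvisible_lipOverhang_frakA_closed`,
`familyNuOverhang_conclusion_of_nuLip_closed`); the registry row E-074L (ls-theory g1 2026-08-27T00:01:15Z:
`NuMeanInvisible` on the Lipschitz ν-overhang sub-class in the absolute `𝔞`-currency) reads «theorem-in-tree,
unconditional (c′-eventual)»; E-074 itself (BV / jump profiles) is untouched (derivation S, inert). The RELATIVE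
verdict of `familyNuLipOverhangAll` keeps its two kind-(b) binders in the statement (`Re ρ = ½`, `Re 𝔠*·Re ω ≥ 0` on
the index set) — here they are discharged in the c′-eventual reading (`familyNuLipOverhangAll_verdict_closed`), the
same move as the N12 leaves p476246 (`KnifeEdgeEndgameClosed`) / p477630 (`KnifeEdgeEndgameClosedBlen`, which left
E-20 to its owner because of `Prop71`). Reading of «eventually in `c′`»: `c′` is the free «(large) constant» of the
restated gap assertion (2.13)/(Prop. 2.2 (iii), p. 5); every theorem below holds for all `c′ ≥ c₀` with ONE
`c₀ ≥ 0` supplied by `Skeleton.partOne_eventually` — exactly the manuscript's «for some (large) constant c′ > 0».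

Contents: `partOne71_eventually` (the four nodes under one threshold) · `discWeight_le_frakAScale_closed` ·
`nuMeanInvisible_lipOverhang_frakA_closed` · `not_nuCloses_lipOverhang_frakA_closed` ·
`mainTerm_add_nuPiece_lipOverhang_frakA_closed` · `familyNuLipOverhangAll_mainTerm_add_closed` ·
`familyNuOverhang_conclusion_of_nuLip_closed` · `familyNuLipOverhangAll_verdict_closed` ·
`KnifeEdge.abs_discMean_add_nuPoly_sub_le_closed`. Cell files: barrier/REF-E.md v0.36 §4 E-20 (445f914629d3676e),
BARRIER-STATE §2′ N12, obj/EDREGISTRY E-074 / E-074L, HANDOFF § ls-Blen-typer-2.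
[cite: Zhang2022LandauSiegel, §2 Prop. 2.2, Lemma 2.3, (2.16), (2.31); §3 (3.5); §4 (4.8); §7 Prop 7.1; §8 Lemma 8.1]
«The programme SEARCHES and TYPES; no claim about Landau–Siegel zeros, Theorems 1–2 of arXiv:2211.02515 or a
repaired Margin232 until a kernel theorem says so.»
-/

noncomputable section

open Complex Real Set

namespace Literature.NumberTheory.LFunctions.Zhang2022

namespace Repair

open KnifeEdge Skeleton

/-! ### Part 1 — the four displayed nodes of E-20's absolute currency under ONE threshold -/

/-- **Prop 7.1, Lemma 8.1, Prop 2.2 (i), Lemma 2.3 — all four for every sufficiently large `c′`** (one `c₀ ≥ 0`):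
`Section7cStatements.prop71X_holds` (every `c′`) and `Skeleton.partOne_eventually` (Prop 2.2 ⊇ (i), Lemma 2.3,
Lemma 8.1). No hypothesis, no fact. [cite: Zhang2022LandauSiegel, §7 Prop 7.1; §8 Lemma 8.1; §2 Prop. 2.2, Lemma 2.3] -/
theorem partOne71_eventually : ∃ c₀ : ℝ, 0 ≤ c₀ ∧ ∀ c' : ℝ, c₀ ≤ c' →
    Prop71 c' ∧ Lemma81 c' ∧ Prop22i ∧ Lemma23 c' := by
  obtain ⟨c₀, h0, h⟩ := Skeleton.partOne_eventually
  exact ⟨c₀, h0, fun c' hc' =>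
    ⟨Section7cStatements.prop71X_holds c', (h c' hc').2.2.1, (h c' hc').1.1, (h c' hc').2.1⟩⟩

/-! ### Part 2 — E-20's absolute currency (scale `𝔞`), CLOSED: no displayed node left -/

/-- **The weight-mass binder at scale `𝔞`, closed:** for every sufficiently large `c′` there is `W` with
`discWeight ≤ W·𝓛⁹·(𝔞·𝔓)` for all large `D` under (A) (`discWeight_le_frakAScale` ∘ Part 1).
[cite: Zhang2022LandauSiegel, §7 Prop 7.1, §8 Lemma 8.1, §2 (2.31)] -/
theorem discWeight_le_frakAScale_closed : ∃ c₀ : ℝ, 0 ≤ c₀ ∧ ∀ c' : ℝ, c₀ ≤ c' →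
    ∃ W : ℝ, ForAllLarge fun D _ χ => AssumptionA D χ →
      KnifeEdge.discWeight c' χ ≤ W * ell D ^ 9 * (frakAScale D χ * frakP D) := by
  obtain ⟨c₀, h0, h⟩ := partOne71_eventually
  refine ⟨c₀, h0, fun c' hc' => ?_⟩
  obtain ⟨h71, h81, h22, h23⟩ := h c' hc'
  exact discWeight_le_frakAScale c' h71 h81 h22 h23

/-- **MEAN-INVISIBILITY OF THE LIPSCHITZ ν-CLASS AT SCALE `𝔞`, UNCONDITIONAL (c′-eventual):** there is `c₀ ≥ 0`
such that for every `c′ ≥ c₀` and every top `1 < θ ≤ 2`, `NuMeanInvisible c′ θ (lipOverhang θ) frakAScale` — E-17's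
E-074′ slot on the Lipschitz image is a THEOREM with no displayed node (E-074L of the registry).
[cite: Zhang2022LandauSiegel, §2 (2.16), (2.31), §3 (3.5), §4 (4.8), §7 Prop 7.1, §8 Lemma 8.1] -/
theorem nuMeanInvisible_lipOverhang_frakA_closed : ∃ c₀ : ℝ, 0 ≤ c₀ ∧ ∀ c' : ℝ, c₀ ≤ c' →
    ∀ θ : ℝ, 1 < θ → θ ≤ 2 → NuMeanInvisible c' θ (lipOverhang θ) frakAScale := by
  obtain ⟨c₀, h0, h⟩ := partOne71_eventually
  refine ⟨c₀, h0, fun c' hc' θ hθ1 hθ2 => ?_⟩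
  obtain ⟨h71, h81, h22, h23⟩ := h c' hc'
  exact nuMeanInvisible_lipOverhang_frakA hθ1 hθ2 h71 h81 h22 h23

/-- **THE DOOR IS SHUT for the Lipschitz ν-class at scale `𝔞`, unconditionally (c′-eventual):** dictionary of
record `(M, X) = (0, 0)` AND no closing (`KnifeEdge.not_nuCloses_of_invisible`, p461177), for every `c′ ≥ c₀` and
every `1 < θ ≤ 2`. [cite: Zhang2022LandauSiegel, §2 (2.16), Lemma 2.3, Prop. 2.2 (i), §7 Prop 7.1, §8 Lemma 8.1] -/
theorem not_nuCloses_lipOverhang_frakA_closed : ∃ c₀ : ℝ, 0 ≤ c₀ ∧ ∀ c' : ℝ, c₀ ≤ c' →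
    ∀ θ : ℝ, 1 < θ → θ ≤ 2 →
      NuDict c' θ (lipOverhang θ) frakAScale (fun _ _ => 0) 0 ∧ ¬ NuCloses (lipOverhang θ) (fun _ _ => 0) 0 := by
  obtain ⟨c₀, h0, h⟩ := partOne71_eventually
  refine ⟨c₀, h0, fun c' hc' θ hθ1 hθ2 => ?_⟩
  obtain ⟨h71, h81, h22, h23⟩ := h c' hc'
  exact not_nuCloses_lipOverhang_frakA hθ1 hθ2 h71 h81 h22 h23

/-- **No lever of either sign at scale `𝔞`, unconditionally (c′-eventual):** for every `c′ ≥ c₀`, every bulk test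
family with main constant `m ≥ 0` at scale `𝔞` (shape of `Eval823`) keeps `m` after a Lipschitz νψ-overhang of top
`θ ∈ (1, 2]` is added — ls-theory's «TRUE(u ⊕ v_ν) = TRUE(u)» as a kernel theorem with no displayed node.
[cite: Zhang2022LandauSiegel, §2 (2.16), (2.31), §4 (4.8), §7 Prop 7.1, §8 Lemma 8.1, (8.23)] -/
theorem mainTerm_add_nuPiece_lipOverhang_frakA_closed : ∃ c₀ : ℝ, 0 ≤ c₀ ∧ ∀ c' : ℝ, c₀ ≤ c' →
    ∀ θ : ℝ, 1 < θ → θ ≤ 2 → ∀ m : ℝ, 0 ≤ m →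
      ∀ F : (D : ℕ) → [NeZero D] → DirichletCharacter ℂ D → Skeleton.Chr D → ℂ → ℂ,
        (∀ ε : ℝ, 0 < ε → ForAllLarge fun D _ χ => AssumptionA D χ →
          |KnifeEdge.discMean c' χ (F D χ) - m * frakAScale D χ * frakP D| ≤ ε * frakAScale D χ * frakP D) →
        ∀ v v' : ℝ → ℂ, lipOverhang θ v v' →
          ∀ ε : ℝ, 0 < ε → ForAllLarge fun D _ χ => AssumptionA D χ →
            |KnifeEdge.discMean c' χ (fun x s => F D χ x s + nuPoly χ x v ⌈bigP D ^ θ⌉₊ s)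
                - m * frakAScale D χ * frakP D| ≤ ε * frakAScale D χ * frakP D := by
  obtain ⟨c₀, h0, h⟩ := partOne71_eventually
  refine ⟨c₀, h0, fun c' hc' θ hθ1 hθ2 m hm F hF v v' hv => ?_⟩
  obtain ⟨h71, h81, h22, h23⟩ := h c' hc'
  exact mainTerm_add_nuPiece_lipOverhang_frakA hθ1 hθ2 h71 h81 h22 h23 hm hF hv

/-- **For the family's members, absolute currency, unconditionally (c′-eventual):** every
`d ∈ familyNuLipOverhangAll` glued to a bulk with main constant `m ≥ 0` at scale `𝔞` keeps `m`, for every `c′ ≥ c₀`.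
[cite: Zhang2022LandauSiegel, §2 (2.16), §7 Prop 7.1, §8 Lemma 8.1] -/
theorem familyNuLipOverhangAll_mainTerm_add_closed : ∃ c₀ : ℝ, 0 ≤ c₀ ∧ ∀ d : NuLipDesign, d.InClass →
    ∀ c' : ℝ, c₀ ≤ c' → ∀ m : ℝ, 0 ≤ m →
      ∀ F : (D : ℕ) → [NeZero D] → DirichletCharacter ℂ D → Skeleton.Chr D → ℂ → ℂ,
        (∀ ε : ℝ, 0 < ε → ForAllLarge fun D _ χ => AssumptionA D χ →
          |KnifeEdge.discMean c' χ (F D χ) - m * frakAScale D χ * frakP D| ≤ ε * frakAScale D χ * frakP D) →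
        ∀ ε : ℝ, 0 < ε → ForAllLarge fun D _ χ => AssumptionA D χ →
          |KnifeEdge.discMean c' χ (fun x s => F D χ x s + nuPoly χ x d.v ⌈bigP D ^ d.θ⌉₊ s)
              - m * frakAScale D χ * frakP D| ≤ ε * frakAScale D χ * frakP D := by
  obtain ⟨c₀, h0, h⟩ := partOne71_eventually
  refine ⟨c₀, h0, fun d hd c' hc' m hm F hF => ?_⟩
  obtain ⟨h71, h81, h22, h23⟩ := h c' hc'
  exact familyNuLipOverhangAll_mainTerm_add hd h71 h81 h22 h23 hm hF

/-- **E-17's SLOT DISCHARGED ON THE LIPSCHITZ IMAGE, UNCONDITIONALLY (c′-eventual)** — the conclusion of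
`familyNuOverhang c′ 𝔞`'s verdict (RepairBlenMuNu, p469249) on the image `d.toNuDesign` of every member: dictionary
of record `(M, X) = (0, 0)` and lever-free (`HasMainConstant c′ 𝔞 F m → HasMainConstant c′ 𝔞 (d.toNuDesign.extend F) m`,
every `m ≥ 0`, every bulk `F`), for every `c′ ≥ c₀`, with NO displayed node and NO E-074′ slot.
[cite: Zhang2022LandauSiegel, §2 (2.16), (2.31), §4 (4.8), §7 Prop 7.1, §8 Lemma 8.1] -/
theorem familyNuOverhang_conclusion_of_nuLip_closed : ∃ c₀ : ℝ, 0 ≤ c₀ ∧ ∀ d : NuLipDesign, d.InClass →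
    ∀ c' : ℝ, c₀ ≤ c' →
      NuDict c' d.θ (lipOverhang d.θ) frakAScale (fun _ _ => 0) 0 ∧
        ∀ m : ℝ, 0 ≤ m → ∀ F : (D : ℕ) → [NeZero D] → DirichletCharacter ℂ D → Skeleton.Chr D → ℂ → ℂ,
          HasMainConstant c' frakAScale F m → HasMainConstant c' frakAScale (d.toNuDesign.extend F) m := by
  obtain ⟨c₀, h0, h⟩ := partOne71_eventually
  refine ⟨c₀, h0, fun d hd c' hc' => ?_⟩
  obtain ⟨h71, h81, h22, h23⟩ := h c' hc'
  exact familyNuOverhang_conclusion_of_nuLip hd h71 h81 h22 h23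

/-! ### Part 3 — the RELATIVE verdict and p468144's transfer theorem with the kind-(b) binders discharged -/

/-- **The family verdict of `familyNuLipOverhangAll` WITHOUT displayed binders, unconditionally (c′-eventual):**
for every member `d` and every `c′ ≥ c₀`, for all large `D`, every real primitive `χ`, every bulk `F`:
`¬ (δ·(Ξ(F) + W) + δ²·W < |Ξ(F + A_ν) − Ξ(F)|)`, `δ = 4K·𝓛^{−180}` (`familyNuLipOverhangAll_verdict_of_prop22i`
∘ `Skeleton.prop22i_holds` / `lemma23_eventually`). [cite: Zhang2022LandauSiegel, §2 Prop. 2.2 (i), Lemma 2.3, (2.16); §4 (4.8)] -/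
theorem familyNuLipOverhangAll_verdict_closed : ∃ c₀ : ℝ, 0 ≤ c₀ ∧ ∀ d : NuLipDesign, d.InClass →
    ∀ c' : ℝ, c₀ ≤ c' →
      ForAllLarge fun D _ χ => ∀ F : Skeleton.Chr D → ℂ → ℂ,
        ¬ (d.rate D * (KnifeEdge.discMean c' χ F + KnifeEdge.discWeight c' χ)
              + d.rate D ^ 2 * KnifeEdge.discWeight c' χ <
            |KnifeEdge.discMean c' χ (fun x s => F x s + nuPoly χ x d.v ⌈bigP D ^ d.θ⌉₊ s)
              - KnifeEdge.discMean c' χ F|) := by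
  obtain ⟨c₀, h0, h⟩ := partOne71_eventually
  refine ⟨c₀, h0, fun d hd c' hc' => ?_⟩
  obtain ⟨-, -, h22, h23⟩ := h c' hc'
  exact familyNuLipOverhangAll_verdict_of_prop22i hd h22 h23

end Repair

namespace KnifeEdge

open Repair Skeleton

/-- **The transfer theorem of p468144 with `Prop22i` / `Lemma23 c′` discharged (c′-eventual):** for every `c′ ≥ c₀`,
for all large `D` and every `χ`, every `1 < θ ≤ 2`, every `K`-Lipschitz `v` vanishing off `[1,θ]`, every family of
test values `F`: `|Ξ(F + A_ν) − Ξ(F)| ≤ δ·(Ξ(F) + W) + δ²·W`, `δ = 4K·𝓛^{−180}` — no hypothesis, no fact.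
[cite: Zhang2022LandauSiegel, §2 Prop. 2.2 (i), Lemma 2.3, (2.16), §3 (3.5), §4 (4.8)] -/
theorem abs_discMean_add_nuPoly_sub_le_closed : ∃ c₀ : ℝ, 0 ≤ c₀ ∧ ∀ c' : ℝ, c₀ ≤ c' →
    ForAllLarge fun D _ χ => ∀ θ : ℝ, 1 < θ → θ ≤ 2 →
      ∀ (v : ℝ → ℂ) (K : NNReal), LipschitzWith K v → (∀ z, z < 1 ∨ θ < z → v z = 0) →
        ∀ F : Chr D → ℂ → ℂ,
          |discMean c' χ (fun x s => F x s + nuPoly χ x v ⌈bigP D ^ θ⌉₊ s) - discMean c' χ F| ≤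
            4 * K * (ell D ^ 180)⁻¹ * (discMean c' χ F + discWeight c' χ)
              + (4 * K * (ell D ^ 180)⁻¹) ^ 2 * discWeight c' χ := by
  obtain ⟨c₀, h0, h⟩ := Repair.partOne71_eventually
  refine ⟨c₀, h0, fun c' hc' => ?_⟩
  obtain ⟨-, -, h22, h23⟩ := h c' hc'
  exact abs_discMean_add_nuPoly_sub_le_of_prop22i c' h22 h23

end KnifeEdge

end Literature.NumberTheory.LFunctions.Zhang2022

end
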